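import Literature.AlgebraicGeometry.HodgeTheory.SimpleAbelianElevenThirteenfoldHodgeClasses
import Literature.AlgebraicGeometry.Motives.HodgeThetaSubalgebraUnitaryFourOddCore
import HarnessLib

/-!
# Hodge classes on all powers of abelian varieties of Ribet type `(4, g − 4)`, `g` odd, are generated by divisor classes
# (Ribet 1983 Thm. 3 at multiplicities `(4, n″)`, `n″` odd — UNCONDITIONAL, classification-free)

Family `hodge`, layer `Literature/AlgebraicGeometry/HodgeTheory`. Research context: cell `pub-hodge-ring2` (HONEST
FRAMING: research route conditional on HC_CM; not a corollary; Q11.4-sentence-2 already refuted in dim ≥ 3),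
Literature lane gen 83, programme R65. UNCONDITIONAL for the class of abelian varieties it names; theorems only, no
definition, no named fact (D-0026), no `sorry`. The CELL of the generic assembly `RibetTypeOfCorePowersHodgeClasses` at the
family core `UnitaryFourOdd.eq_top` / `eq_top'` (`Motives/HodgeThetaSubalgebraUnitaryFourOddCore`): a complex abelian
variety `A` of ODD dimension `g ≥ 5` with `φ ≫ φ = −d`, `finrank_ℚ End⁰(A) = 2` (`End⁰ = k` imaginary quadratic) and a
multiplicity equal to `4` has `B•(Aⁿ) = D•(Aⁿ) ⊗ ℂ` for all `n`, hence the Hodge conjecture for all its powers. With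
the tree's type-one, `(2, odd)` and `(3, 3∤·)` theorems: Ribet's Thm. 3 is now an unconditional theorem of the tree
whenever `min(n′, n″) ≤ 4` (all `g`), plus `(5,7)`, `(6,7)`. Census: in prime dimension `13` only `End⁰ = ℚ` and the
signature `{5, 8}` remain (`isDivisorGenerated_powSucc_of_isSimple_thirteenfold'`).

THE PRINTED THEOREM. Ribet, Amer. J. Math. 105 (1983), Thm. 3 = Gordon's survey Thm. 6.3 (3) [held
`paper:arxiv-alg-geom_9709030` p. 18].

## References
* [Ribet1983] K. A. Ribet, Amer. J. Math. 105 (1983), Thm. 0, Thm. 3.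
* [Gordon1997] B. B. Gordon, *A survey of the Hodge conjecture for abelian varieties*, Thm. 6.3 (3) and Corollary.
* [MoonenZarhin1999LowDim] B. Moonen, Yu. Zarhin, Math. Ann. 315 (1999), §2 (2.4), Thm. (2.7).
* [Deligne2000] P. Deligne, *The Hodge conjecture* (Clay, 2000), §1.
-/

noncomputable section

open CategoryTheory Module

namespace Literature.AlgebraicGeometry.HodgeTheory

open Literature.AlgebraicGeometry.Motives
open Literature.AlgebraicGeometry.Motives.HodgeStructure

section Cells

/-- **Ribet 1983 Thm. 3 at `(4, g − 4)`, `g` odd — UNCONDITIONAL: `B•(A^{N+1}) = D•(A^{N+1}) ⊗ ℂ`** for a complex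
abelian variety `A` of odd dimension with `φ ≫ φ = -d` (`d > 0`), `finrank_ℚ End⁰(A) = 2` and one multiplicity of `φ`
equal to `4` (core `UnitaryFourOdd.eq_top` / `eq_top'`). [cite: Ribet1983, Thm. 0 and Thm. 3]
[cite: Gordon1997, Thm. 6.3 (3) and Corollary] -/
theorem AbelianVariety.isDivisorGenerated_powSucc_of_ribetTypeFourOdd (A : AbelianVariety ℂ) (φ : A ⟶ A)
    {d : ℕ} (hd : 0 < d) (hφ : φ ≫ φ = -(d • 𝟙 A)) (hE2 : Module.finrank ℚ A.endAlgebra = 2) (hodd : Odd A.dim)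
    (h4 : eigenMultiplicity A φ (Complex.I * (Real.sqrt d : ℂ)) = 4 ∨
      eigenMultiplicity A φ (-(Complex.I * (Real.sqrt d : ℂ))) = 4) (N : ℕ) :
    IsDivisorGenerated (A.powSucc N) := by
  have hsum := eigenMultiplicity_add_eigenMultiplicity_neg_eq_dim A φ hd hφ
  obtain ⟨k, hk⟩ := hodd
  refine AbelianVariety.isDivisorGenerated_powSucc_of_ribetType_ofCore A φ hd hφ hE2 (by omega) (by omega) ?_ N
  intro W' _ _ _ 𝔊 ι P' Q' s hbr hirr hι hιι hP' hQ' hfinP' hfinQ' hadd hsymm hPQ hdefP hdefQ hadj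
  rcases h4 with h | h
  · exact UnitaryFourOdd.eq_top hbr hirr hι hιι hP' hQ' (by rw [hfinP', h]) ⟨k - 2, by rw [hfinQ']; omega⟩
      hadd hsymm hPQ hdefP hdefQ hadj
  · exact UnitaryFourOdd.eq_top' hbr hirr hι hιι hP' hQ' ⟨k - 2, by rw [hfinP']; omega⟩ (by rw [hfinQ', h])
      hadd hsymm hPQ hdefP hdefQ hadj

/-- **The Hodge conjecture for all powers of an odd-dimensional abelian variety of unitary type `(4, g − 4)` —
UNCONDITIONAL.** [cite: Ribet1983, Thm. 3] [cite: Deligne2000, §1] -/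
theorem hodgeConjectureFor_powSucc_of_ribetTypeFourOdd (A : AbelianVariety ℂ) (φ : A ⟶ A)
    {d : ℕ} (hd : 0 < d) (hφ : φ ≫ φ = -(d • 𝟙 A)) (hE2 : Module.finrank ℚ A.endAlgebra = 2) (hodd : Odd A.dim)
    (h4 : eigenMultiplicity A φ (Complex.I * (Real.sqrt d : ℂ)) = 4 ∨
      eigenMultiplicity A φ (-(Complex.I * (Real.sqrt d : ℂ))) = 4) (N : ℕ) :
    HodgeConjectureFor (A.powSucc N).dim (A.powSucc N).X :=
  hodgeConjectureFor_of_isDivisorGenerated _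
    (AbelianVariety.isDivisorGenerated_powSucc_of_ribetTypeFourOdd A φ hd hφ hE2 hodd h4 N)

end Cells

/-! ### Census: prime dimension 13 after the `(4, 9)` cell -/

section Census

variable {X : AbelianVariety ℂ}

/-- **`B•(X^{N+1}) = D•(X^{N+1})` for a SIMPLE complex abelian THIRTEENFOLD, granted only `End⁰(X) = ℚ` (`h1`) and the
imaginary-quadratic signature `{5, 8}` (`h58`)** — the signature `{4, 9}` is now the unconditional
`AbelianVariety.isDivisorGenerated_powSucc_of_ribetTypeFourOdd`. [cite: MoonenZarhin1999LowDim, §2 (2.4) and Thm. (2.7)]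
[cite: Ribet1983, Thms. 0–3] [cite: Gordon1997, Thm. 6.3 and Corollary] -/
theorem isDivisorGenerated_powSucc_of_isSimple_thirteenfold' (hs : X.IsSimple) (hX : X.dim = 13)
    (h1 : Module.finrank ℚ X.endAlgebra = 1 → ∀ N : ℕ, IsDivisorGenerated (X.powSucc N))
    (h58 : ∀ (φ : X ⟶ X) (d : ℕ), 0 < d → φ ≫ φ = -(d • 𝟙 X) → Module.finrank ℚ X.endAlgebra = 2 →
      (eigenMultiplicity X φ (Complex.I * (Real.sqrt d : ℂ)) = 5 ∨
        eigenMultiplicity X φ (Complex.I * (Real.sqrt d : ℂ)) = 8) → ∀ N : ℕ, IsDivisorGenerated (X.powSucc N))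
    (N : ℕ) : IsDivisorGenerated (X.powSucc N) := by
  refine isDivisorGenerated_powSucc_of_isSimple_thirteenfold hs hX h1 (fun φ d hd hφ he2 h49 N => ?_) h58 N
  have hsum := eigenMultiplicity_add_eigenMultiplicity_neg_eq_dim X φ hd hφ
  rw [hX] at hsum
  have h4 : eigenMultiplicity X φ (Complex.I * (Real.sqrt d : ℂ)) = 4 ∨
      eigenMultiplicity X φ (-(Complex.I * (Real.sqrt d : ℂ))) = 4 := by omega
  exact AbelianVariety.isDivisorGenerated_powSucc_of_ribetTypeFourOdd X φ hd hφ he2 (by rw [hX]; exact ⟨6, rfl⟩) h4 N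

/-- **The Hodge conjecture for all powers of a simple complex abelian THIRTEENFOLD, granted `End⁰ = ℚ` and `{5, 8}`.**
[cite: MoonenZarhin1999LowDim, §2 Thm. (2.7)] [cite: Deligne2000, §1] -/
theorem hodgeConjectureFor_powSucc_of_isSimple_thirteenfold' (hs : X.IsSimple) (hX : X.dim = 13)
    (h1 : Module.finrank ℚ X.endAlgebra = 1 → ∀ N : ℕ, IsDivisorGenerated (X.powSucc N))
    (h58 : ∀ (φ : X ⟶ X) (d : ℕ), 0 < d → φ ≫ φ = -(d • 𝟙 X) → Module.finrank ℚ X.endAlgebra = 2 →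
      (eigenMultiplicity X φ (Complex.I * (Real.sqrt d : ℂ)) = 5 ∨
        eigenMultiplicity X φ (Complex.I * (Real.sqrt d : ℂ)) = 8) → ∀ N : ℕ, IsDivisorGenerated (X.powSucc N))
    (N : ℕ) : HodgeConjectureFor (X.powSucc N).dim (X.powSucc N).X :=
  hodgeConjectureFor_of_isDivisorGenerated _ (isDivisorGenerated_powSucc_of_isSimple_thirteenfold' hs hX h1 h58 N)

end Census

end Literature.AlgebraicGeometry.HodgeTheory

end
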